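import Summits.QuantumFields.YangMills.Theorems.BalabanUVNodesN26AtTheta13OfThm1CStubD4OfDriftTowerFlat
import Literature.MathematicalPhysics.QuantumFieldTheory.Balaban1983to89.Node00.Record13NumericsOfThm1CC1

/-!
# DAG node N26 ∕ row (D4) — CRUX K2⁗ `EndpointGivenBR13Sep` (stmt-QuantumFields-20291) — THE REGISTERED (D4) STUB `stub_d4AtSlopeCont13 : D4AtSlopeOfD1Record13`'s BODY
# AT EVERY MEMBER BELOW A THRESHOLD along node00-def-K0a's ALL-NUMERICS LIVE WITNESS FAMILY
# `θ₁₃(n, e) = theta13LiveOfNumerics F N n e (zeta316OfRecord F N n.ν n.τ9.M n.A₁) (RzOfRecord F N) (ZtOfRecord F N)`, GENERIC IN THE NUMERICS `n`, NODE D SUPPLIED, the β-side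
# rows PAID, under the displayed drift floor `hdrift` — the DOWNWARD-CLOSED and WITNESS-GENERIC form of (F) `…N26AtTheta13OfThm1CStubD4OfDriftTowerFlat` (p503596);
# θ₁₅ᶜ = θ₁₃(stage12NumericsOfThm1C F.L ε₀ B₃ a₀ a₁, ·) and θ₁₅ᶜᶜ¹ = θ₁₃(stage12NumericsOfThm1CC1 F.L ε₀ B₃ B₃′ a₀ a₁, ·) are `rfl` members (§2 checks both)

Cell pub-balaban, β-function sub-cell, BINDER row (D4) OWNER lineage `b2b-balaban-beta-an4` (gen 131; `--supports stmt-QuantumFields-20291`; memo `HOME/b2b-balaban-beta-an4/FLAT-LETTERS-LOCATED.md`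
§42).  Context.  (F) proved: under ONE displayed (D1)-side letter `hdrift` (dag-n26-c's `hd₀`, p502604) there is ONE member `ε₂₉(d₀)` of θ₁₅ᶜ at which the registered stub's BODY holds
modulo the NODE O ∕ B ∕ E inputs.  (1) The YM-PLAN knit consuming the (D4) lane at a witness family (ym-nodeO-ideate P3 EVIDENCE-58 §11 (v) `endAtInhabited13_thetaC_of_regAt_family`,
EVIDENCE-59 `…_below` ∕ `…_of_classAt_regAt_family`) reads the lanes as ROWS BELOW THRESHOLDS and takes the member at `min ē₀ (min ē₁ ē₂)`; plan g67's v8 K0 stub is ONE ∃-tuple — a single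
`∃ ε₂₉` of this lane's choosing composes with neither, a downward-closed row does; and every β-side row of this lane IS an upper bound on the (2.9) letter (N1 small row; the seam
`ε₂₉·K_rem,L ≤ d₀` with ONE coefficient along the family; `4ε₂₉ < ε₀`; admissibility ∕ `ZtUnity` at every `ε₂₉ > 0`), so (F)'s member argument is a THRESHOLD argument.  (2) The K0
witness is being re-pinned (K0a FILE 13a–13d: θ₁₅ᶜᶜ¹ = `theta13OfThm1CC1`, p505383 ∕ p505696 ∕ p506286; plan V8-CALL: v8 keys θ₁₅ᶜ, v9 may re-base on θ₁₅ᶜᶜ¹; P3 EVIDENCE-59: «CondsL rows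
at θ₁₅ᶜᶜ¹ = the next typed input»).  Both witnesses are `rfl` members of K0a's ALL-NUMERICS LIVE FAMILY (`Node00/Record13LiveSelectorFamily.lean` §3) at K0b's residuals of record, and
this lane's rows read `n` ONLY through the κ threshold (dag-n26-c p492818 `condsL_faithful_theta13LiveOfNumerics_iff_of_kappa_ge`, generic in `n`), the sign windows `n.Pos` (K0a
`admissible_theta13LiveOfNumerics`) and the letters of record `c13OfRecord₁₂` (reading `ℓ₆, γ, s2` — not the (2.9) letter).  So the rows-below form is typed ONCE along `e ↦ θ₁₃(n, e)`.

WHAT THIS FILE PROVES (0 `def`, 0 `sorry`):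
* §0 generic in `n`: `c13OfRecord₁₂_theta13LiveOfNumerics_eq` (letters `e`-blind), `remCoeffL_faithful_theta13LiveOfNumerics_eq` (ONE seam coefficient), `condsL_faithful_theta13LiveOfNumerics_of_eps_le`
  (use form of p492818's iff), ★ `exists_thr_rows_theta13LiveOfNumerics (hκ) (hn) (hs)`: `∃ ē > 0, ∀ e, 0 < e → e ≤ ē →` [`4e < n.ν.ε₀` ∧ Admissible ∧ `ZtUnity` ∧ N1 at the faithful letters
  `{ c₀ with ε₁ := e, A₂ := e·576·K₀(64,8)² }` ∧ `e·K_rem,L ≤ s`] — the rows-below twin, generic in `n`, of dag-n26-c's member lemma `exists_eps29_rows_theta13OfThm1C` (p497784 §1c).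
* §1 ★ `exists_thr_d4AtSlopeOfD1Record13_below_theta13LiveOfNumerics_of_drift_towerFlat (hκ) (hnum)` — (F)'s statement with `theta13OfThm1C F N ε₀ · B₃ a₀ a₁ ↦ θ₁₃(n, ·)`, `ε₀ ↦ n.ν.ε₀`,
  and the member prefix `∃ ε₂₉, …` replaced by `∃ ē > 0, ∀ ε₂₉, 0 < ε₂₉ → ε₂₉ ≤ ē → …`; AT EVERY SUCH MEMBER, from the NODE O ∕ 00 ∕ A, NODE B, NODE E inputs there + N3 + `0 < γ₀` + `Valid`
  + (C-leaf) ALONE, FOR EVERY (D1) DATUM pinned on the member's `β⁰` with its residue: `∃ γ₁, 0 < γ₁ ∧ γ₁ ≤ θ₁₃(n,ε₂₉).γ ∧ AtSlopeCont (split₁₃ θ₁₃(n,ε₂₉)) γ₁ (stepBal Nc Lc)`.  At `N := 2`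
  this is P3's `RowBelow (D4RegAt F) Θ ē` for `Θ := θ₁₅ᶜ(·)` (`n := stage12NumericsOfThm1C …`, EVIDENCE-58) resp. `Θ := θ₁₅ᶜᶜ¹(·)` (`n := stage12NumericsOfThm1CC1 …`, EVIDENCE-59) MODULO the
  displayed objects at each member and `hdrift`.
* §2 `exists_thr_rows_theta13OfThm1C`, `exists_thr_rows_theta13OfThm1CC1` — the `rfl`-member CHECKS: §0 AT θ₁₅ᶜ and AT θ₁₅ᶜᶜ¹ as TERMS `exists_thr_rows_theta13LiveOfNumerics … (n := …) …`
  against the witness-spelled statements (K0a `theta13OfThm1C_eq` ∕ `theta13OfThm1CC1_eq` are `rfl`) — §1 specialises to either witness the same way at a consumer's use site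
  (as a TERM under `set_option maxRecDepth 100000 in` — default depth overflows on §1's size; farm-checked at θ₁₅ᶜᶜ¹ — or after `simp only [theta13OfThm1CC1_eq]`).

HONEST FRAMING.  A REDUCTION along one family below a threshold — NOT a proof of `stub_d4AtSlopeCont13` (above the threshold the (D4) road does not reach the tuple); `hdrift` a HYPOTHESIS;
the NODE O ∕ B ∕ E inputs DISPLAYED per member, proved nowhere; NODE D on the MODEL class; (D4) INSTANCE 0∕1, D4 DISCHARGE NO DATE; K2⁗ NOT proved; N25 ∕ N26 NOT discharged; counts
unmoved.  One finite 𝕋⁴ programme at fixed ε per run — NOT continuum, NOT ℝ⁴, NOT infinite volume, NOT OS, NOT a mass gap, NOT Clay.  No `instance`, no `notation`, no `axiom`.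
Sources (context): [I] = [Balaban1987RG1] CMP **109** (1987): Thm 2 p. 259, (1.3) p. 260, (1.7) p. 261, (1.18) p. 263, (1.20)–(1.22) p. 264, (2.9) p. 266, (2.12)–(2.13) p. 268,
(4.4) p. 281, (4.35) p. 290, (5.1) p. 292; [II] = [Balaban1988RG2Cluster] CMP **116** (1988): Lemma 3 (2.38) p. 20, p. 21; [III] = [Balaban1988Convergent] CMP **119** (1988):
(2.4) p. 255, (2.10) p. 256; [IV] = [Balaban1989LargeFieldI] CMP **122** (1989): (0.3) p. 176; [15] = [Balaban1985Variational] CMP **102** (1985): Thm 1 p. 279, (190) p. 308.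
-/

noncomputable section

open scoped Matrix.Norms.L2Operator InnerProductSpace ComplexConjugate

namespace Summit.QuantumFields.YangMills.Theorems.BalabanUVNodesN26AtTheta13LiveStubD4BelowOfDriftTowerFlat

open Literature.MathematicalPhysics.QuantumFieldTheory.Balaban1983to89
open Literature.MathematicalPhysics.QuantumFieldTheory.Balaban1983to89.FlowStep
open Literature.MathematicalPhysics.QuantumFieldTheory.Balaban1983to89.T4Continuum (T4Family)
open Literature.MathematicalPhysics.QuantumFieldTheory.Balaban1983to89.Node00
open Literature.MathematicalPhysics.QuantumFieldTheory.Balaban1983to89.B13ScaleTransfer (Pt)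
open Literature.MathematicalPhysics.QuantumFieldTheory.Balaban1983to89.TreeLengthTorus (TPt TDom proj)
open Literature.MathematicalPhysics.QuantumFieldTheory.Balaban1983to89.B4Sect5Torus (TSite)
open Literature.MathematicalPhysics.QuantumFieldTheory.Balaban1983to89.B12Decay510 (mixedDeriv)
open Literature.MathematicalPhysics.QuantumFieldTheory.Balaban1983to89.B12Decay510Torus (tcubeOf)
open Literature.MathematicalPhysics.QuantumFieldTheory.Balaban1983to89.B9SectCLatticeCarrier (Bond bpos)
open Literature.MathematicalPhysics.QuantumFieldTheory.Balaban1983to89.B9Eq311L2Pairing (WL2)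
open Literature.MathematicalPhysics.QuantumFieldTheory.Balaban1983to89.B9Eq315QTower (towerP UlevOf)
open Literature.MathematicalPhysics.QuantumFieldTheory.Balaban1983to89.B9Eq315QTorus (perCfg cornerSite)
open Literature.MathematicalPhysics.QuantumFieldTheory.Balaban1983to89.B9Eq319QprimeTorus (blockCoord)
open Literature.MathematicalPhysics.QuantumFieldTheory.Balaban1983to89.B9Eq316TowerFlatIsOneStep (siteCast towerP_eq_fineP_pow)
open Literature.MathematicalPhysics.QuantumFieldTheory.Balaban1983to89.B7Prop1Explicit (U1 Wcx boxVec)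
open Literature.MathematicalPhysics.QuantumFieldTheory.Balaban1983to89.B7Prop2Explicit (c2')
open Literature.MathematicalPhysics.QuantumFieldTheory.Balaban1983to89.B11Eq103H1Complex (BondL2K)
open Literature.MathematicalPhysics.QuantumFieldTheory.Balaban1983to89.B9Eq326OperatorTower (laplaceAk H1k)
open Literature.MathematicalPhysics.QuantumFieldTheory.Balaban1983to89.Beta.RemainderChainLattice
open Literature.MathematicalPhysics.QuantumFieldTheory.Balaban1983to89.Beta.RemainderLimitTorus (LDom limKernel tproj)
open Literature.MathematicalPhysics.QuantumFieldTheory.Balaban1983to89.Beta.RemainderDecay190 (Consts190 Data190)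
open Literature.MathematicalPhysics.QuantumFieldTheory.Balaban1983to89.Beta.RemainderDecay190HoloChain (ChainTFac190H)
open Literature.MathematicalPhysics.QuantumFieldTheory.Balaban1983to89.Beta.RemainderWOfRecordB13 (SpLaw Law213 NOfLayers)
open Summit.QuantumFields.BalabanUV.Gaps
open Summit.QuantumFields.BalabanUV.Gaps.BetaContFromD4Chain
open Summit.QuantumFields.YangMills.Theorems.BalabanUVNodesN26AtRecord13FamilyTowerFlat
  (exists_chainTFac190H_betaOfRecord₁₃_of_family_towerFlat)
open Literature.MathematicalPhysics.QuantumFieldTheory.Balaban1983to89.B12TreeDecay (K₀ K₀_pos)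
open Summit.QuantumFields.YangMills.Theorems.BalabanUVNodesN26AtRecord13Family (condsL_faithful_theta13LiveOfNumerics_iff_of_kappa_ge)
open Summit.QuantumFields.YangMills.Theorems.BalabanUVNodesN26AtRecord12KappaSufficient (kappaThreshold_le_2e4)
open Metric Filter Topology
open Literature.MathematicalPhysics.QuantumFieldTheory.Balaban1983to89.Beta.OneStepKernelFamily (TbalOf)
open Literature.MathematicalPhysics.QuantumFieldTheory.Balaban1983to89.Beta.OneStepResolventKernel (JetData)

variable (F : T4Family) (N : ℕ) [NeZero N]

/-! ## §0 Faces generic in the numerics `n`, and ★ the β-side rows BELOW A THRESHOLD along `e ↦ θ₁₃(n, e)` -/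

section RowsBelowLive

variable (n : Stage12Numerics) (c₀ : B13.Consts) (M : ℕ) (α₂ B : ℝ)

/-- **The letters of record along the live family do not read the (2.9) letter** (`c13OfRecord₁₂` reads `ℓ₆, γ, s2` only; these are `e`-free, one-sided `rfl`s). [cite: Balaban1988RG2Cluster, p.9, p.21 (after (2.41)); Balaban1987RG1, (0.1) p.251, (1.18) p.263 (bookkeeping)] -/
theorem c13OfRecord₁₂_theta13LiveOfNumerics_eq (e e' : ℝ) (c : B13.Consts) :
    c13OfRecord₁₂ F N (theta13LiveOfNumerics F N n e (zeta316OfRecord F N n.ν n.τ9.M n.A₁) (RzOfRecord F N) (ZtOfRecord F N)).toStage12Params c =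
      c13OfRecord₁₂ F N (theta13LiveOfNumerics F N n e' (zeta316OfRecord F N n.ν n.τ9.M n.A₁) (RzOfRecord F N) (ZtOfRecord F N)).toStage12Params c := by
  have hℓ : ∀ x : ℝ, (theta13LiveOfNumerics F N n x (zeta316OfRecord F N n.ν n.τ9.M n.A₁) (RzOfRecord F N) (ZtOfRecord F N)).ℓ₆ = (stage3OfFamily F).ℓ₆ :=
    fun _ => rfl
  have hγ : ∀ x : ℝ, (theta13LiveOfNumerics F N n x (zeta316OfRecord F N n.ν n.τ9.M n.A₁) (RzOfRecord F N) (ZtOfRecord F N)).γ = n.γ := fun _ => rfl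
  have hs : ∀ x : ℝ, (theta13LiveOfNumerics F N n x (zeta316OfRecord F N n.ν n.τ9.M n.A₁) (RzOfRecord F N) (ZtOfRecord F N)).s2 = n.s2 := fun _ => rfl
  simp only [c13OfRecord₁₂, hℓ, hγ, hs]

/-- **ONE seam coefficient along the family**: `remCoeffL 4 M c α₂ B` reads `A₂, A₁, E₀, K₀(c), L, κ, δ₀` only and the letters of record do not see `e`, so at the faithful letters
`{ c₀ with ε₁ := x }` of `θ₁₃(n, e)` it is the number read at `e = 0`, `c₀`. [cite: Balaban1988RG2Cluster, (2.38) p.20 and p.21 (after (2.41)); Balaban1987RG1, (1.22) p.264 and (5.10) p.293 (bookkeeping)] -/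
theorem remCoeffL_faithful_theta13LiveOfNumerics_eq (e x : ℝ) :
    remCoeffL 4 M (c13OfRecord₁₂ F N (theta13LiveOfNumerics F N n e (zeta316OfRecord F N n.ν n.τ9.M n.A₁) (RzOfRecord F N) (ZtOfRecord F N)).toStage12Params
        { c₀ with ε₁ := x }) α₂ B =
      remCoeffL 4 M (c13OfRecord₁₂ F N (theta13LiveOfNumerics F N n 0 (zeta316OfRecord F N n.ν n.τ9.M n.A₁) (RzOfRecord F N) (ZtOfRecord F N)).toStage12Params c₀) α₂ B := by
  rw [c13OfRecord₁₂_theta13LiveOfNumerics_eq F N n e 0]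
  rfl

variable {n c₀} in
/-- **USE FORM — N1 AT THE FAITHFUL LETTERS OF `θ₁₃(n, ε₂₉)` FROM THE κ THRESHOLD AND THE TWO DISPLAYED INEQUALITIES** (dag-n26-c p492818 `condsL_faithful_theta13LiveOfNumerics_iff_of_kappa_ge`, `.2`):
the small row `2(F.L+2)⁴·A₁·(E₀(n)·K₀(c₀))·ε₂₉·e^{5κ(n)+1}·K₀(64,8)·576 ≤ 1` and the `A₂` row. [cite: Balaban1988RG2Cluster, p.7 (after (1.21)), p.21 (after (2.39) and after (2.41)); Balaban1987RG1, (1.18) p.263 and (2.9) p.266] -/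
theorem condsL_faithful_theta13LiveOfNumerics_of_eps_le {ε₂₉ : ℝ} (hκ : 20 * (64 * Real.log 162 + 1) ≤ n.s2.lf.κ)
    (hsmall : 2 * ((F.L : ℝ) + 2) ^ 4 * c₀.A₁ * (n.s2.lf.E₀ * c₀.K₀) * ε₂₉ * Real.exp (5 * n.s2.lf.κ + 1) * K₀ 64 8 * 9 * 64 ≤ 1)
    (hA₂ : Real.exp 1 * 9 * 64 * K₀ 64 8 ^ 2 ≤ c₀.A₂) :
    CondsL 4 (c13OfRecord₁₂ F N (theta13LiveOfNumerics F N n ε₂₉ (zeta316OfRecord F N n.ν n.τ9.M n.A₁) (RzOfRecord F N) (ZtOfRecord F N)).toStage12Params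
        { c₀ with ε₁ := ε₂₉ })
      (((c13OfRecord₁₂ F N (theta13LiveOfNumerics F N n ε₂₉ (zeta316OfRecord F N n.ν n.τ9.M n.A₁) (RzOfRecord F N) (ZtOfRecord F N)).toStage12Params
        { c₀ with ε₁ := ε₂₉ }).L : ℝ) / 2) :=
  (condsL_faithful_theta13LiveOfNumerics_iff_of_kappa_ge F N ε₂₉ (zeta316OfRecord F N n.ν n.τ9.M n.A₁) (RzOfRecord F N) (ZtOfRecord F N) c₀ hκ).2
    ⟨hsmall, hA₂⟩

variable {n} in
/-- **★ ROWS G, Z, N26's N1 ROW AND THE SEAM ROW `e·K_rem,L ≤ s` ALONG `e ↦ θ₁₃(n, e)` BELOW ONE THRESHOLD, FOR EVERY NUMERICS `n` MEETING THE κ THRESHOLD AND THE SIGN WINDOWS**: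
for residual `c₀`, cube side `M`, (4.4)-radius `α₂`, activity letter `B`, slope `s > 0` THERE IS `ē > 0` — `ē := min (min (ε₀(n) ∕ 8) (1 ∕ (|C| + 1))) (s ∕ (|K| + 1))`,
`C := 2(F.L+2)⁴·A₁·(E₀(n)·K₀(c₀))·e^{5κ(n)+1}·K₀(64,8)·576`, `K := K_rem,L` at the member `e = 0` — such that EVERY member `θ₁₃(n, e)`, `0 < e ≤ ē`, has `4e < ε₀(n)`, is Stage-13
ADMISSIBLE (K0a `admissible_theta13LiveOfNumerics`), carries `ZtUnity` (K0a `ztUnity_theta13LiveOfNumerics`), meets N1 at its faithful letters `{ c₀ with ε₁ := e, A₂ := e·576·K₀(64,8)² }` AND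
the seam row.  Every row is an UPPER bound on the (2.9) letter, so the rows are inherited downward and the threshold composes with other lanes' thresholds by `min` — the rows-below twin,
generic in `n`, of dag-n26-c's `exists_eps29_rows_theta13OfThm1C` (p497784 §1c, same proof).  Satisfiability of displayed rows; elementary inequalities; nothing of Bałaban's; instance 0∕1.
[cite: Balaban1987RG1, (0.21) p.256, (1.2) p.260, (2.9) p.266 and (1.22) p.264; Balaban1988RG2Cluster, Lemma 3 (2.38) p.20 and p.21 (after (2.39), after (2.41)); Balaban1988Convergent, (2.4) p.255, (2.10) p.256; Balaban1989LargeFieldI, (0.3) p.176] -/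
theorem exists_thr_rows_theta13LiveOfNumerics (hκ : 20 * (64 * Real.log 162 + 1) ≤ n.s2.lf.κ) (hn : n.Pos) {s : ℝ} (hs : 0 < s) :
    ∃ ē : ℝ, 0 < ē ∧ ∀ e : ℝ, 0 < e → e ≤ ē →
      4 * e < n.ν.ε₀ ∧
      (theta13LiveOfNumerics F N n e (zeta316OfRecord F N n.ν n.τ9.M n.A₁) (RzOfRecord F N) (ZtOfRecord F N)).Admissible F N ∧
      (theta13LiveOfNumerics F N n e (zeta316OfRecord F N n.ν n.τ9.M n.A₁) (RzOfRecord F N) (ZtOfRecord F N)).ZtUnity F N ∧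
      CondsL 4 (c13OfRecord₁₂ F N (theta13LiveOfNumerics F N n e (zeta316OfRecord F N n.ν n.τ9.M n.A₁) (RzOfRecord F N) (ZtOfRecord F N)).toStage12Params
          { c₀ with ε₁ := e, A₂ := Real.exp 1 * 9 * 64 * K₀ 64 8 ^ 2 })
        (((c13OfRecord₁₂ F N (theta13LiveOfNumerics F N n e (zeta316OfRecord F N n.ν n.τ9.M n.A₁) (RzOfRecord F N) (ZtOfRecord F N)).toStage12Params
          { c₀ with ε₁ := e, A₂ := Real.exp 1 * 9 * 64 * K₀ 64 8 ^ 2 }).L : ℝ) / 2) ∧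
      e * remCoeffL 4 M (c13OfRecord₁₂ F N (theta13LiveOfNumerics F N n e (zeta316OfRecord F N n.ν n.τ9.M n.A₁) (RzOfRecord F N) (ZtOfRecord F N)).toStage12Params
          { c₀ with ε₁ := e, A₂ := Real.exp 1 * 9 * 64 * K₀ 64 8 ^ 2 }) α₂ B ≤ s := by
  have hε : 0 < n.ν.ε₀ := hn.1.1
  set P : ℝ := 2 * ((F.L : ℝ) + 2) ^ 4 * c₀.A₁ * (n.s2.lf.E₀ * c₀.K₀) * Real.exp (5 * n.s2.lf.κ + 1) * K₀ 64 8 * 9 * 64 with hP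
  set K : ℝ := remCoeffL 4 M (c13OfRecord₁₂ F N (theta13LiveOfNumerics F N n 0 (zeta316OfRecord F N n.ν n.τ9.M n.A₁) (RzOfRecord F N) (ZtOfRecord F N)).toStage12Params
    { c₀ with A₂ := Real.exp 1 * 9 * 64 * K₀ 64 8 ^ 2 }) α₂ B with hK
  refine ⟨min (min (n.ν.ε₀ / 8) (1 / (|P| + 1))) (s / (|K| + 1)), lt_min (lt_min (by positivity) (by positivity)) (by positivity), ?_⟩
  intro e he0 hle
  have he1 : e ≤ n.ν.ε₀ / 8 := hle.trans ((min_le_left _ _).trans (min_le_left _ _))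
  have he2 : e ≤ 1 / (|P| + 1) := hle.trans ((min_le_left _ _).trans (min_le_right _ _))
  have he3 : e ≤ s / (|K| + 1) := hle.trans (min_le_right _ _)
  refine ⟨by linarith, admissible_theta13LiveOfNumerics F N _ _ _ hn he0, ztUnity_theta13LiveOfNumerics F N n e, ?_, ?_⟩
  · refine condsL_faithful_theta13LiveOfNumerics_of_eps_le F N (c₀ := { c₀ with A₂ := Real.exp 1 * 9 * 64 * K₀ 64 8 ^ 2 }) hκ ?_ le_rfl
    show 2 * ((F.L : ℝ) + 2) ^ 4 * c₀.A₁ * (n.s2.lf.E₀ * c₀.K₀) * e * Real.exp (5 * n.s2.lf.κ + 1) * K₀ 64 8 * 9 * 64 ≤ 1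
    have eq : 2 * ((F.L : ℝ) + 2) ^ 4 * c₀.A₁ * (n.s2.lf.E₀ * c₀.K₀) * e * Real.exp (5 * n.s2.lf.κ + 1) * K₀ 64 8 * 9 * 64 = P * e := by
      rw [hP]; ring
    rw [eq]
    calc P * e ≤ |P| * e := mul_le_mul_of_nonneg_right (le_abs_self P) he0.le
      _ ≤ |P| * (1 / (|P| + 1)) := mul_le_mul_of_nonneg_left he2 (abs_nonneg P)
      _ = |P| / (|P| + 1) := by ring
      _ ≤ 1 := by rw [div_le_one (by positivity)]; linarith
  · rw [remCoeffL_faithful_theta13LiveOfNumerics_eq F N n { c₀ with A₂ := Real.exp 1 * 9 * 64 * K₀ 64 8 ^ 2 } M α₂ B e e, ← hK]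
    calc e * K ≤ e * |K| := mul_le_mul_of_nonneg_left (le_abs_self K) he0.le
      _ ≤ s / (|K| + 1) * |K| := mul_le_mul_of_nonneg_right he3 (abs_nonneg K)
      _ = s * (|K| / (|K| + 1)) := by ring
      _ ≤ s * 1 := mul_le_mul_of_nonneg_left (by rw [div_le_one (by positivity)]; linarith) hs.le
      _ = s := mul_one s

end RowsBelowLive

section BelowTheta13LiveOfDrift



-- NE9's tower structure data ([5] §3 ∕ [15]: block size `L ≥ 3`, the C⋆-algebra `𝔸`, its Hilbert model `W ≃ 𝔸`, the trace `τ`, `a, a′, ρ_w, A_Q`; the letters `a, a′` are `aQ, aQ'` here — K0a's witness owns the names `a₀, a₁`)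
variable (L : ℕ) [NeZero L] (hL : 1 ≤ L) (hL3 : 3 ≤ L)
  {𝔸 : Type*} [CStarAlgebra 𝔸] [Nontrivial 𝔸]
  {W : Type} [NormedAddCommGroup W] [InnerProductSpace ℂ W] [FiniteDimensional ℂ W] (φ : W ≃ₗ[ℂ] 𝔸)
  {Mφ Mφ' : ℝ} (hMφ : 0 ≤ Mφ) (hMφ' : 0 ≤ Mφ') (hφ : ∀ w, ‖φ w‖ ≤ Mφ * ‖w‖) (hφ' : ∀ X, ‖φ.symm X‖ ≤ Mφ' * ‖X‖)
  {aQ : ℝ} (haQ : 0 < aQ) {aQ' : ℝ} (haQ' : 0 < aQ')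
  (τ : 𝔸 →ₗ[ℂ] ℂ) {Cτ : ℝ} (hτ : ∀ X, ‖τ X‖ ≤ Cτ * ‖X‖) (hCτ : 0 ≤ Cτ) {Mτ : ℝ}
  (hτm : ∀ X Y : 𝔸, ‖τ (X * Y)‖ ≤ Mτ * ‖X‖ * ‖Y‖) (hMτ : 0 ≤ Mτ) {ρw : ℝ} (hρw : 0 ≤ ρw)
  (hτ₁ : ∀ X : 𝔸, τ (star X) = conj (τ X)) (hτ₂ : ∀ X Y : 𝔸, τ (X * Y) = τ (Y * X))
  (hφτ : ∀ X Y : 𝔸, ⟪φ.symm X, φ.symm Y⟫_ℂ = τ (star X * Y))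
  (AQ : ℝ) (hAQ16 : 16 * (((4 : ℕ) : ℝ) + 1) * (((4 : ℕ) : ℝ) + 4) * c2' 4 L ≤ AQ)

include hL3 hMφ hMφ' hφ hφ' haQ haQ' hτ hCτ hτm hMτ hρw hτ₁ hτ₂ hφτ hAQ16

variable (n : Stage12Numerics)

variable {n} in
/-- **★ CRUX K2⁗ `EndpointGivenBR13Sep` (stmt-QuantumFields-20291) — THE REGISTERED (D4) STUB `stub_d4AtSlopeCont13 : D4AtSlopeOfD1Record13`'s BODY AT EVERY MEMBER BELOW A THRESHOLD OF K0a's ALL-NUMERICS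
LIVE FAMILY `θ₁₃(n, ε₂₉)`, FOR EVERY NUMERICS `n` MEETING THE κ THRESHOLD `hκ` AND THE SIGN WINDOWS `hnum : n.Pos`, NODE D SUPPLIED, THE β-SIDE ROWS PAID, UNDER THE DISPLAYED DRIFT FLOOR `hdrift`** (the
rows-below and witness-generic form of (F) `exists_eps29_d4AtSlopeOfD1Record13_at_theta13OfThm1C_of_drift_towerFlat`, p503596): for NE9's structure data and thresholds `(δs, Cs)`, tower weights,
cube side `M` ∕ geometry ∕ numerics on `q`, box `γ₀`, channel `(μ, ν)`, (4.4)-radius `α₂`, residual `c₀`, and `d₀ > 0` with `hdrift : ∀ e, 0 < e → 4e < ε₀(n) → θ₁₃(n,e).Admissible → ∀ (Lc, Js, Nc),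
[β⁰(θ₁₃(n,e)) pinned on secondMoment (TbalOf Lc Js ·) 0 1] → Residue Lc Js Nc 0 1 → d₀ ≤ stepBal Nc Lc` (dag-n26-c's `hd₀` shape along the family), THERE IS `ē > 0` (§0's, at `s := d₀`) such that
AT EVERY MEMBER `0 < ε₂₉ ≤ ē`: `4ε₂₉ < ε₀(n)`, Stage-13 ADMISSIBLE, `ZtUnity`, and — from the Stage-12 [B13] family of record at the faithful letters `{ c₀ with ε₁ := ε₂₉, A₂ := e·576·K₀(64,8)² }` with
N10's leaf and the letters law, the leaf kernels with the (1.22) identification at the ₁₃ merged β, the run sequences ∕ laws ∕ `Restr` (NODE O ∕ 00 ∕ A), N3, ANY regularity display ∕ positivity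
witness, the (4.4) seams from the tower's fine bond fields with holomorphic activities (NODE B), the (1.7) data with `hconv` on the explicit flat (4.35) vectors and the read-out (NODE E), `0 < γ₀`,
`Valid` and (C-leaf) ALONE — FOR EVERY (D1) DATUM `(Lc, Js, Nc)` pinned on the member's `β⁰` with `D1Residue.Residue Lc Js Nc 0 1`: `∃ γ₁, 0 < γ₁ ∧ γ₁ ≤ θ₁₃(n,ε₂₉).γ ∧ AtSlopeCont (split₁₃
θ₁₃(n,ε₂₉)) γ₁ (stepBal Nc Lc)` (witness `γ₁ := γ₀`; p492935 clause (ii) per member with `hsmall := (ε₂₉·K_rem,L ≤ d₀).trans (hdrift …)`).  SPECIALISATIONS (`rfl` members, checked in §2): `n :=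
stage12NumericsOfThm1C F.L ε₀ B₃ a₀ a₁` gives ym-nodeO-ideate P3's `RowBelow (D4RegAt F) (fun e => theta13OfThm1C F 2 ε₀ e B₃ a₀ a₁) ē` (EVIDENCE-58 §11 (v)), `n := stage12NumericsOfThm1CC1 F.L ε₀ B₃
B₃' a₀ a₁` gives `RowBelow (D4RegAt F) (fun e => theta13OfThm1CC1 F 2 ε₀ e B₃ B₃' a₀ a₁) ē` (EVIDENCE-59), both MODULO the displayed NODE O ∕ B ∕ E inputs at each member + N3 + `Valid` + (C-leaf)
and `hdrift` — obtained as TERMS of the witness-spelled statements under `set_option maxRecDepth 100000 in` at the use site (the default recursion depth overflows on a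
statement of this size; farm-checked at θ₁₅ᶜᶜ¹, 16 s, 0 warnings), or after `simp only [theta13OfThm1CC1_eq]`; §2's rows corollaries need neither.  A REDUCTION — NOT a proof of the stub; `hdrift` a HYPOTHESIS; nothing of Bałaban's objects asserted; NODE D on the MODEL class; (D4) instance 0∕1; K2⁗ NOT proved.
[cite: Balaban1987RG1, Thm 2 p.259, (1.3) p.260, (1.7) p.261, (1.18) p.263, (1.20)-(1.22) p.264, (2.9) p.266, (2.12)-(2.13) p.268, (4.4) p.281, (4.35) p.290, (5.1) p.292; Balaban1988RG2Cluster, Lemma 3 (2.38) p.20 and p.21; Balaban1988Convergent, (2.4) p.255, (2.10) p.256; Balaban1989LargeFieldI, (0.3) p.176; Balaban1985Variational, Thm 1 p.279, (190) p.308] -/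
theorem exists_thr_d4AtSlopeOfD1Record13_below_theta13LiveOfNumerics_of_drift_towerFlat
    (hκ : 20 * (64 * Real.log 162 + 1) ≤ n.s2.lf.κ) (hnum : n.Pos) :
    ∃ δs Cs : ℝ, 0 < δs ∧ 0 ≤ Cs ∧
      ∀ -- tower weights per scale `k` (height `k + 1`)
        (η : ℕ → ℝ) (_hηL : ∀ k, η k * (L : ℝ) ^ (k + 1) = 1) (cw₀ cw₁ : ℕ → ℝ) [∀ k, Fact (0 < cw₀ k)] [∀ k, Fact (0 < cw₁ k)]
        (_hw : ∀ k, cw₀ k * ((L : ℝ) ^ (k + 1)) ^ 4 = cw₁ k) (_hρ : ∀ k, |η k| ^ 4 / cw₀ k ≤ ρw)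
        -- cube side, size indices, block-geometry letters, source direction ∕ value, the (190)-record under numerics only
        (M : ℕ) [NeZero M] (I : Type) (_i₀ : I) (η₀ L₀ M₀ Rg : ℕ → ℝ) (Hg : ℕ → Prop) (μ₀ : Fin 4) (w₀ : W)
        (q : Consts190) (δr : ℝ) (_hδr : 0 < δr) (_hσ₀ : 0 < q.σ) (_hcR : B6.c0 δr (q.σ / δr) ^ 4 ≤ q.cR) (_hκB : 1 ≤ q.κB)
        (_hδ15 : q.δ15 ≤ δs) (_hCst : Cs ≤ q.Cst) (_hmw : ‖w₀‖ ≤ q.m) (_hθ1 : q.θ ≤ 1)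
        (γ₀ : ℝ) (μ ν : Fin 4) (α₂ : ℝ) (c₀ : B13.Consts)
        -- THE ONE (D1)-SIDE LETTER: a positive floor `d₀` of the slopes `stepBal Nc Lc` of ALL (D1) data pinned on the record's `β⁰` at EVERY admissible member
        -- (the (D1) lane's ∕ N25's sentence in Cesàro form — [I] (2.12)–(2.13): `β⁰` does not read the (2.9) threshold; dag-n26-c g8 `hd₀`)
        (d₀ : ℝ) (_hd₀ : 0 < d₀)
        (_hdrift : ∀ e : ℝ, 0 < e → 4 * e < n.ν.ε₀ → (theta13LiveOfNumerics F N n e (zeta316OfRecord F N n.ν n.τ9.M n.A₁) (RzOfRecord F N) (ZtOfRecord F N)).Admissible F N →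
          letI := (theta13LiveOfNumerics F N n e (zeta316OfRecord F N n.ν n.τ9.M n.A₁) (RzOfRecord F N) (ZtOfRecord F N)).instVβ₁; letI := (theta13LiveOfNumerics F N n e (zeta316OfRecord F N n.ν n.τ9.M n.A₁) (RzOfRecord F N) (ZtOfRecord F N)).instVβ₂
          letI := (theta13LiveOfNumerics F N n e (zeta316OfRecord F N n.ν n.τ9.M n.A₁) (RzOfRecord F N) (ZtOfRecord F N)).instιβ
          ∀ (Lc : ℕ) (_ : NeZero Lc) (Js : ℕ → JetData 3 Lc) (Nc : ℝ),
            (∀ j, beta0OfMerged (betaMerged F (mergedTermFamilyMatT F N (TcanOfRecord F N)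
                (chiFixed29 F N (theta13LiveOfNumerics F N n e (zeta316OfRecord F N n.ν n.τ9.M n.A₁) (RzOfRecord F N) (ZtOfRecord F N)).ν (theta13LiveOfNumerics F N n e (zeta316OfRecord F N n.ν n.τ9.M n.A₁) (RzOfRecord F N) (ZtOfRecord F N)).ε₂₉)
                (theta13LiveOfNumerics F N n e (zeta316OfRecord F N n.ν n.τ9.M n.A₁) (RzOfRecord F N) (ZtOfRecord F N)).εbg) (theta13LiveOfNumerics F N n e (zeta316OfRecord F N n.ν n.τ9.M n.A₁) (RzOfRecord F N) (ZtOfRecord F N)).ρ8 (theta13LiveOfNumerics F N n e (zeta316OfRecord F N n.ν n.τ9.M n.A₁) (RzOfRecord F N) (ZtOfRecord F N)).bV) (theta13LiveOfNumerics F N n e (zeta316OfRecord F N n.ν n.τ9.M n.A₁) (RzOfRecord F N) (ZtOfRecord F N)).v₀ j =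
              B12Beta.secondMoment (TbalOf Lc Js j) 0 1) →
            D1Residue.Residue Lc Js Nc 0 1 →
            d₀ ≤ B12Normalization.stepBal Nc Lc),
      -- ★ A THRESHOLD, AND THE ROW AT EVERY MEMBER BELOW IT (downward-closed in the (2.9) letter `ε₂₉`)
      ∃ ē : ℝ, 0 < ē ∧ ∀ ε₂₉ : ℝ, 0 < ε₂₉ → ε₂₉ ≤ ē →
      4 * ε₂₉ < n.ν.ε₀ ∧ (theta13LiveOfNumerics F N n ε₂₉ (zeta316OfRecord F N n.ν n.τ9.M n.A₁) (RzOfRecord F N) (ZtOfRecord F N)).Admissible F N ∧ (theta13LiveOfNumerics F N n ε₂₉ (zeta316OfRecord F N n.ν n.τ9.M n.A₁) (RzOfRecord F N) (ZtOfRecord F N)).ZtUnity F N ∧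
      ∀ -- AT THAT MEMBER: a Stage-12 [B13] FAMILY of record with the FAITHFUL letters (minimal `A₂`), the box, the leaf kernels with the (1.22) identification
        (lamF : ResidB13Fam₁₂ F N (theta13LiveOfNumerics F N n ε₂₉ (zeta316OfRecord F N n.ν n.τ9.M n.A₁) (RzOfRecord F N) (ZtOfRecord F N)).toStage12Params)
        (_hle : γ₀ ≤ (theta13LiveOfNumerics F N n ε₂₉ (zeta316OfRecord F N n.ν n.τ9.M n.A₁) (RzOfRecord F N) (ZtOfRecord F N)).γ) (A1 : (k : ℕ) → (Fin (k + 1) → ℝ) → LDom 4 → Pt 4 → ℝ)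
        (_hm : letI := (theta13LiveOfNumerics F N n ε₂₉ (zeta316OfRecord F N n.ν n.τ9.M n.A₁) (RzOfRecord F N) (ZtOfRecord F N)).instVβ₁; letI := (theta13LiveOfNumerics F N n ε₂₉ (zeta316OfRecord F N n.ν n.τ9.M n.A₁) (RzOfRecord F N) (ZtOfRecord F N)).instVβ₂
          letI := (theta13LiveOfNumerics F N n ε₂₉ (zeta316OfRecord F N n.ν n.τ9.M n.A₁) (RzOfRecord F N) (ZtOfRecord F N)).instιβ
          ∀ k (v : Fin (k + 1) → ℝ), v ∈ Box γ₀ k →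
            betaMerged F (mergedTermFamilyMatT F N (TcanOfRecord F N)
                (chiFixed29 F N (theta13LiveOfNumerics F N n ε₂₉ (zeta316OfRecord F N n.ν n.τ9.M n.A₁) (RzOfRecord F N) (ZtOfRecord F N)).ν (theta13LiveOfNumerics F N n ε₂₉ (zeta316OfRecord F N n.ν n.τ9.M n.A₁) (RzOfRecord F N) (ZtOfRecord F N)).ε₂₉)
                (theta13LiveOfNumerics F N n ε₂₉ (zeta316OfRecord F N n.ν n.τ9.M n.A₁) (RzOfRecord F N) (ZtOfRecord F N)).εbg) (theta13LiveOfNumerics F N n ε₂₉ (zeta316OfRecord F N n.ν n.τ9.M n.A₁) (RzOfRecord F N) (ZtOfRecord F N)).ρ8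
                (theta13LiveOfNumerics F N n ε₂₉ (zeta316OfRecord F N n.ν n.τ9.M n.A₁) (RzOfRecord F N) (ZtOfRecord F N)).bV k v =
              beta0OfMerged (betaMerged F (mergedTermFamilyMatT F N (TcanOfRecord F N)
                  (chiFixed29 F N (theta13LiveOfNumerics F N n ε₂₉ (zeta316OfRecord F N n.ν n.τ9.M n.A₁) (RzOfRecord F N) (ZtOfRecord F N)).ν (theta13LiveOfNumerics F N n ε₂₉ (zeta316OfRecord F N n.ν n.τ9.M n.A₁) (RzOfRecord F N) (ZtOfRecord F N)).ε₂₉)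
                  (theta13LiveOfNumerics F N n ε₂₉ (zeta316OfRecord F N n.ν n.τ9.M n.A₁) (RzOfRecord F N) (ZtOfRecord F N)).εbg) (theta13LiveOfNumerics F N n ε₂₉ (zeta316OfRecord F N n.ν n.τ9.M n.A₁) (RzOfRecord F N) (ZtOfRecord F N)).ρ8
                  (theta13LiveOfNumerics F N n ε₂₉ (zeta316OfRecord F N n.ν n.τ9.M n.A₁) (RzOfRecord F N) (ZtOfRecord F N)).bV) (theta13LiveOfNumerics F N n ε₂₉ (zeta316OfRecord F N n.ν n.τ9.M n.A₁) (RzOfRecord F N) (ZtOfRecord F N)).v₀ k +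
                B12Beta.secondMoment (fun _ _ => limKernel (A1 k v)) μ ν)
        -- N10's in-edge in the FAMILY currency at every run and the member letters law on the box, at the Stage-12 part (faithful letters of record of the member)
        (_hcF : ∀ P k v, v ∈ Box γ₀ k → (lamF P k v).c = c13OfRecord₁₂ F N (theta13LiveOfNumerics F N n ε₂₉ (zeta316OfRecord F N n.ν n.τ9.M n.A₁) (RzOfRecord F N) (ZtOfRecord F N)).toStage12Params { c₀ with ε₁ := ε₂₉, A₂ := Real.exp 1 * 9 * 64 * K₀ 64 8 ^ 2 })
        (_hleafF : ∀ P, B13FamLeafOfRecord₁₂ F N (theta13LiveOfNumerics F N n ε₂₉ (zeta316OfRecord F N n.ν n.τ9.M n.A₁) (RzOfRecord F N) (ZtOfRecord F N)).toStage12Params { c₀ with ε₁ := ε₂₉, A₂ := Real.exp 1 * 9 * 64 * K₀ 64 8 ^ 2 } lamF P)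
        -- per (scale, history) IN THE BOX: a RUN SEQUENCE whose members AT THAT HISTORY have growing coarse tori, their laws and restriction sentences
        (Ps : (k : ℕ) → (Fin (k + 1) → ℝ) → ℕ → B12.RunParams)
        (_hn : ∀ k v, v ∈ Box γ₀ k → Tendsto (fun m => (lamF (Ps k v m) k v).n) atTop atTop)
        (_hsp : ∀ k v, v ∈ Box γ₀ k → ∀ m, SpLaw (lamF (Ps k v m) k v))
        (_h213 : ∀ k v, v ∈ Box γ₀ k → ∀ m, Law213 (lamF (Ps k v m) k v))
        (_hR : ∀ k v, v ∈ Box γ₀ k → ∀ m, (lamF (Ps k v m) k v).Restr)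
        -- N3 (N1 and the seam row are PAID by the choice of the member and `hdrift`)
        (_hs : SignsL (c13OfRecord₁₂ F N (theta13LiveOfNumerics F N n ε₂₉ (zeta316OfRecord F N n.ν n.τ9.M n.A₁) (RzOfRecord F N) (ZtOfRecord F N)).toStage12Params { c₀ with ε₁ := ε₂₉, A₂ := Real.exp 1 * 9 * 64 * K₀ 64 8 ^ 2 }) α₂ q.B₃)
        -- ANY admissible regularity display and positivity witness of `Δ_{a,k}(1)` per (k, v, m) on the tower over the member's torus
        (αU : (k : ℕ) → (Fin (k + 1) → ℝ) → ℕ → ℕ → ℝ) (hα1 : ∀ k v m j, αU k v m j ≤ 1 / 64)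
        (hαL : ∀ k v m j, 50 * (((4 : ℕ) : ℝ) + 1) * αU k v m j * (L : ℝ) ^ 4 ≤ 1 / 2)
        (hU1 : ∀ k v m (j : ℕ) (z : B7Prop1Explicit.Site 4) (κ : Fin 4),
          perCfg (towerP L (fun _ : Fin 4 => NOfLayers (fun m => lamF (Ps k v m) k v) m * M) (j + 1))
            (UlevOf L (fun _ : Fin 4 => NOfLayers (fun m => lamF (Ps k v m) k v) m * M) (k + 1) (fun _ => (1 : 𝔸ˣ)) j) z κ ∈ U1 𝔸)
        (hreg : ∀ k v m (j : ℕ) (y : TSite 4 (towerP L (fun _ : Fin 4 => NOfLayers (fun m => lamF (Ps k v m) k v) m * M) j)) (κ : Fin 4)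
          (ρ' : Fin 4 → Fin L),
          ‖((Wcx L (perCfg (towerP L (fun _ : Fin 4 => NOfLayers (fun m => lamF (Ps k v m) k v) m * M) (j + 1))
              (UlevOf L (fun _ : Fin 4 => NOfLayers (fun m => lamF (Ps k v m) k v) m * M) (k + 1) (fun _ => (1 : 𝔸ˣ)) j))
              (cornerSite L y) κ (boxVec L ρ') : 𝔸ˣ) : 𝔸) - 1‖ ≤ αU k v m j)
        (hpos : ∀ k v m (u : BondL2K ℂ 4 (towerP L (fun _ : Fin 4 => NOfLayers (fun m => lamF (Ps k v m) k v) m * M) (k + 1)) (cw₀ k) W), u ≠ 0 →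
          0 < RCLike.re ⟪u, laplaceAk L (fun _ : Fin 4 => NOfLayers (fun m => lamF (Ps k v m) k v) m * M) k φ (η k) (fun _ => (1 : 𝔸ˣ)) hL
            (αU k v m) (hα1 k v m) (hU1 k v m) (hreg k v m) τ (c₀ := cw₀ k) (c₁ := cw₁ k) aQ u⟫_ℂ)
        -- the (4.4) seams FROM THE TOWER's FINE BOND FIELDS into the members' spaces p. 15, the members' ACTIVITIES holomorphic along them (on the box)
        (emb : (k : ℕ) → (v : Fin (k + 1) → ℝ) → (m : ℕ) → TDom 4 ((lamF (Ps k v m) k v).n + 1) → (Bond 4 (towerP L (fun _ : Fin 4 => NOfLayers (fun m => lamF (Ps k v m) k v) m * M) (k + 1)) → W) → (lamF (Ps k v m) k v).Φ)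
        (_hemb : ∀ k v, v ∈ Box γ₀ k → ∀ m X, ∀ u ∈ ball (0 : Bond 4 (towerP L (fun _ : Fin 4 => NOfLayers (fun m => lamF (Ps k v m) k v) m * M) (k + 1)) → W) α₂, emb k v m X u ∈ (lamF (Ps k v m) k v).sp2 X)
        (_hH : ∀ k v, v ∈ Box γ₀ k → ∀ m (X Z : TDom 4 ((lamF (Ps k v m) k v).n + 1)), Z.1 ⊆ X.1 →
          DifferentiableOn ℂ (fun u => (lamF (Ps k v m) k v).H Z (emb k v m X u)) (ball 0 α₂))
        -- the (1.7) ∕ test-vector-limit data (on the box), the limit READ ON THE EXPLICIT FLAT TEST VECTORS, and the read-out of the leaf kernels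
        (V : (k : ℕ) → (Fin (k + 1) → ℝ) → LDom 4 → Type) (_instV : ∀ k v Y, NormedAddCommGroup (V k v Y))
        (_instVs : ∀ k v Y, NormedSpace ℂ (V k v Y))
        (Fw : (k : ℕ) → (v : Fin (k + 1) → ℝ) → (Y : LDom 4) → V k v Y → ℂ)
        (_hFd : ∀ k v, v ∈ Box γ₀ k → ∀ Y, ∃ ρ > 0, DifferentiableOn ℂ (Fw k v Y) (ball 0 ρ))
        (r : (k : ℕ) → (v : Fin (k + 1) → ℝ) → (m : ℕ) → (Y : LDom 4) → (Bond 4 (towerP L (fun _ : Fin 4 => NOfLayers (fun m => lamF (Ps k v m) k v) m * M) (k + 1)) → W) →L[ℂ] V k v Y)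
        (_hfac : ∀ k v, v ∈ Box γ₀ k → ∀ Y : LDom 4, ∀ᶠ m in atTop, ∀ u ∈ ball (0 : Bond 4 (towerP L (fun _ : Fin 4 => NOfLayers (fun m => lamF (Ps k v m) k v) m * M) (k + 1)) → W) α₂,
          (lamF (Ps k v m) k v).Ek1 (tproj ((lamF (Ps k v m) k v).n + 1) Y) (emb k v m (tproj ((lamF (Ps k v m) k v).n + 1) Y) u) = Fw k v Y (r k v m Y u))
        (t : (k : ℕ) → (v : Fin (k + 1) → ℝ) → (Y : LDom 4) → Pt 4 → V k v Y)
        (_hconv : ∀ k v, v ∈ Box γ₀ k → ∀ (Y : LDom 4) (x : Pt 4),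
          Tendsto (fun m => r k v m Y
            (fun b : Bond 4 (towerP L (fun _ : Fin 4 => NOfLayers (fun m => lamF (Ps k v m) k v) m * M) (k + 1)) =>
              if tcubeOf (NOfLayers (fun m => lamF (Ps k v m) k v) m) M (fun i => ((blockCoord (L ^ (k + 1)) (fun _ : Fin 4 => NOfLayers (fun m => lamF (Ps k v m) k v) m * M)
                    (siteCast (towerP_eq_fineP_pow L (fun _ : Fin 4 => NOfLayers (fun m => lamF (Ps k v m) k v) m * M) (k + 1)) (bpos b)) i : ℕ) :
                      ZMod (NOfLayers (fun m => lamF (Ps k v m) k v) m * M))) ∈ (tproj ((lamF (Ps k v m) k v).n + 1) Y).1 then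
                ((WL2.linearEquiv ℂ ℂ (fun _ : Bond 4 (towerP L (fun _ : Fin 4 => NOfLayers (fun m => lamF (Ps k v m) k v) m * M) (k + 1)) => cw₀ k) :
                    BondL2K ℂ 4 (towerP L (fun _ : Fin 4 => NOfLayers (fun m => lamF (Ps k v m) k v) m * M) (k + 1)) (cw₀ k) W ≃ₗ[ℂ] (Bond 4 (towerP L (fun _ : Fin 4 => NOfLayers (fun m => lamF (Ps k v m) k v) m * M) (k + 1)) → W))
                  (H1k L (fun _ : Fin 4 => NOfLayers (fun m => lamF (Ps k v m) k v) m * M) k φ (η k) (fun _ => (1 : 𝔸ˣ)) hL (αU k v m) (hα1 k v m)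
                    (hU1 k v m) (hreg k v m) τ (c₀ := cw₀ k) (c₁ := cw₁ k) (hαL k v m) (hpos k v m)
                    ((WL2.linearEquiv ℂ ℂ (fun _ : Bond 4 (fun _ : Fin 4 => NOfLayers (fun m => lamF (Ps k v m) k v) m * M) => cw₁ k) :
                        BondL2K ℂ 4 (fun _ : Fin 4 => NOfLayers (fun m => lamF (Ps k v m) k v) m * M) (cw₁ k) W ≃ₗ[ℂ]
                          (Bond 4 (fun _ : Fin 4 => NOfLayers (fun m => lamF (Ps k v m) k v) m * M) → W)).symm
                      (Pi.single ((fun i => (⟨((proj (((lamF (Ps k v m) k v).n + 1) * M) x) i).val,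
                          ZMod.val_lt ((proj (((lamF (Ps k v m) k v).n + 1) * M) x) i)⟩ : Fin (NOfLayers (fun m => lamF (Ps k v m) k v) m * M))), μ₀) w₀)))) b
              else 0)) atTop (𝓝 (t k v Y x)))
        (_ha : ∀ k v, v ∈ Box γ₀ k → ∀ (Y : LDom 4) (z : Pt 4), A1 k v Y z = (mixedDeriv (Fw k v Y) (t k v Y 0) (t k v Y z)).re)
        -- the box is a positive box, the (190) numerics validity at the letters, (C-leaf) in the (1.7) read-out letters
        (_hγ₀ : 0 < γ₀) (_hq : q.Valid (c13OfRecord₁₂ F N (theta13LiveOfNumerics F N n ε₂₉ (zeta316OfRecord F N n.ν n.τ9.M n.A₁) (RzOfRecord F N) (ZtOfRecord F N)).toStage12Params { c₀ with ε₁ := ε₂₉, A₂ := Real.exp 1 * 9 * 64 * K₀ 64 8 ^ 2 }).δ₀)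
        (_hcont : ∀ k (Y : LDom 4) (z : Pt 4),
          ContinuousOn (fun v : Fin (k + 1) → ℝ => (mixedDeriv (Fw k v Y) (t k v Y 0) (t k v Y z)).re) (Box γ₀ k))
        -- EVERY (D1) DATUM OF THE MEMBER, pinned on the record's one-loop numbers (K2‴ stub 1's output at this θ), with its residue
        (Lc : ℕ) (_ : NeZero Lc) (Js : ℕ → JetData 3 Lc) (Nc : ℝ)
        (_hβ : letI := (theta13LiveOfNumerics F N n ε₂₉ (zeta316OfRecord F N n.ν n.τ9.M n.A₁) (RzOfRecord F N) (ZtOfRecord F N)).instVβ₁; letI := (theta13LiveOfNumerics F N n ε₂₉ (zeta316OfRecord F N n.ν n.τ9.M n.A₁) (RzOfRecord F N) (ZtOfRecord F N)).instVβ₂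
          letI := (theta13LiveOfNumerics F N n ε₂₉ (zeta316OfRecord F N n.ν n.τ9.M n.A₁) (RzOfRecord F N) (ZtOfRecord F N)).instιβ
          ∀ j, beta0OfMerged (betaMerged F (mergedTermFamilyMatT F N (TcanOfRecord F N)
              (chiFixed29 F N (theta13LiveOfNumerics F N n ε₂₉ (zeta316OfRecord F N n.ν n.τ9.M n.A₁) (RzOfRecord F N) (ZtOfRecord F N)).ν (theta13LiveOfNumerics F N n ε₂₉ (zeta316OfRecord F N n.ν n.τ9.M n.A₁) (RzOfRecord F N) (ZtOfRecord F N)).ε₂₉)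
              (theta13LiveOfNumerics F N n ε₂₉ (zeta316OfRecord F N n.ν n.τ9.M n.A₁) (RzOfRecord F N) (ZtOfRecord F N)).εbg) (theta13LiveOfNumerics F N n ε₂₉ (zeta316OfRecord F N n.ν n.τ9.M n.A₁) (RzOfRecord F N) (ZtOfRecord F N)).ρ8 (theta13LiveOfNumerics F N n ε₂₉ (zeta316OfRecord F N n.ν n.τ9.M n.A₁) (RzOfRecord F N) (ZtOfRecord F N)).bV) (theta13LiveOfNumerics F N n ε₂₉ (zeta316OfRecord F N n.ν n.τ9.M n.A₁) (RzOfRecord F N) (ZtOfRecord F N)).v₀ j =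
            B12Beta.secondMoment (TbalOf Lc Js j) 0 1)
        (_hres : D1Residue.Residue Lc Js Nc 0 1),
      letI := (theta13LiveOfNumerics F N n ε₂₉ (zeta316OfRecord F N n.ν n.τ9.M n.A₁) (RzOfRecord F N) (ZtOfRecord F N)).instVβ₁; letI := (theta13LiveOfNumerics F N n ε₂₉ (zeta316OfRecord F N n.ν n.τ9.M n.A₁) (RzOfRecord F N) (ZtOfRecord F N)).instVβ₂
      letI := (theta13LiveOfNumerics F N n ε₂₉ (zeta316OfRecord F N n.ν n.τ9.M n.A₁) (RzOfRecord F N) (ZtOfRecord F N)).instιβ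
      ∃ γ₁ : ℝ, 0 < γ₁ ∧ γ₁ ≤ (theta13LiveOfNumerics F N n ε₂₉ (zeta316OfRecord F N n.ν n.τ9.M n.A₁) (RzOfRecord F N) (ZtOfRecord F N)).γ ∧
        AtSlopeCont
          (oneLoopSplit_betaOfMerged
            (betaMerged F (mergedTermFamilyMatT F N (TcanOfRecord F N)
              (chiFixed29 F N (theta13LiveOfNumerics F N n ε₂₉ (zeta316OfRecord F N n.ν n.τ9.M n.A₁) (RzOfRecord F N) (ZtOfRecord F N)).ν (theta13LiveOfNumerics F N n ε₂₉ (zeta316OfRecord F N n.ν n.τ9.M n.A₁) (RzOfRecord F N) (ZtOfRecord F N)).ε₂₉)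
              (theta13LiveOfNumerics F N n ε₂₉ (zeta316OfRecord F N n.ν n.τ9.M n.A₁) (RzOfRecord F N) (ZtOfRecord F N)).εbg) (theta13LiveOfNumerics F N n ε₂₉ (zeta316OfRecord F N n.ν n.τ9.M n.A₁) (RzOfRecord F N) (ZtOfRecord F N)).ρ8
              (theta13LiveOfNumerics F N n ε₂₉ (zeta316OfRecord F N n.ν n.τ9.M n.A₁) (RzOfRecord F N) (ZtOfRecord F N)).bV)
            (beta0OfMerged (betaMerged F (mergedTermFamilyMatT F N (TcanOfRecord F N)
              (chiFixed29 F N (theta13LiveOfNumerics F N n ε₂₉ (zeta316OfRecord F N n.ν n.τ9.M n.A₁) (RzOfRecord F N) (ZtOfRecord F N)).ν (theta13LiveOfNumerics F N n ε₂₉ (zeta316OfRecord F N n.ν n.τ9.M n.A₁) (RzOfRecord F N) (ZtOfRecord F N)).ε₂₉)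
              (theta13LiveOfNumerics F N n ε₂₉ (zeta316OfRecord F N n.ν n.τ9.M n.A₁) (RzOfRecord F N) (ZtOfRecord F N)).εbg) (theta13LiveOfNumerics F N n ε₂₉ (zeta316OfRecord F N n.ν n.τ9.M n.A₁) (RzOfRecord F N) (ZtOfRecord F N)).ρ8
              (theta13LiveOfNumerics F N n ε₂₉ (zeta316OfRecord F N n.ν n.τ9.M n.A₁) (RzOfRecord F N) (ZtOfRecord F N)).bV) (theta13LiveOfNumerics F N n ε₂₉ (zeta316OfRecord F N n.ν n.τ9.M n.A₁) (RzOfRecord F N) (ZtOfRecord F N)).v₀)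
            (theta13LiveOfNumerics F N n ε₂₉ (zeta316OfRecord F N n.ν n.τ9.M n.A₁) (RzOfRecord F N) (ZtOfRecord F N)).γ)
          γ₁ (B12Normalization.stepBal Nc Lc) := by
  obtain ⟨δs, Cs, hδs, hCs, H⟩ :=
    exists_chainTFac190H_betaOfRecord₁₃_of_family_towerFlat F N L hL hL3 φ hMφ hMφ' hφ hφ' haQ haQ' τ hτ hCτ hτm hMτ hρw hτ₁ hτ₂
      hφτ AQ hAQ16
  refine ⟨δs, Cs, hδs, hCs, ?_⟩
  intro η hηL cw₀ cw₁ _ _ hw hρ M _ I i₀ η₀ L₀ M₀ Rg Hg μ₀ w₀ q δr hδr hσ₀ hcR hκB hδ15 hCst hmw hθ1 γ₀ μ ν α₂ c₀ d₀ hd₀ hdrift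
  obtain ⟨ē, hē, hrows⟩ := exists_thr_rows_theta13LiveOfNumerics F N c₀ M α₂ q.B₃ hκ hnum hd₀
  refine ⟨ē, hē, fun ε₂₉ hε0 hεē => ?_⟩
  obtain ⟨h4, hAdm, hZt, hC, hseam⟩ := hrows ε₂₉ hε0 hεē
  refine ⟨h4, hAdm, hZt, ?_⟩
  intro lamF hle A1 hm hcF hleafF Ps hn hsp h213 hR hs αU hα1 hαL hU1 hreg hpos emb hemb hH V instV instVs Fw hFd r hfac t hconv ha
    hγ₀ hq hcont Lc _ Js Nc hβ hres
  exact ⟨γ₀, hγ₀, hle,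
    (H η hηL cw₀ cw₁ hw hρ M I i₀ η₀ L₀ M₀ Rg Hg μ₀ w₀ q δr hδr hσ₀ hcR hκB hδ15 hCst hmw hθ1 γ₀ μ ν α₂ (theta13LiveOfNumerics F N n ε₂₉ (zeta316OfRecord F N n.ν n.τ9.M n.A₁) (RzOfRecord F N) (ZtOfRecord F N))
      { c₀ with ε₁ := ε₂₉, A₂ := Real.exp 1 * 9 * 64 * K₀ 64 8 ^ 2 } lamF hle A1 hm hcF hleafF Ps hn hsp h213 hR hC hs αU hα1 hαL hU1
      hreg hpos emb hemb hH V instV instVs Fw hFd r hfac t hconv ha).2.1 hq _ (hseam.trans (hdrift ε₂₉ hε0 h4 hAdm Lc inferInstance Js Nc hβ hres))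
      hcont⟩

end BelowTheta13LiveOfDrift

/-! ## §2 The `rfl`-member checks at the [15]-keyed witness θ₁₅ᶜ = `theta13OfThm1C F N ε₀ e B₃ a₀ a₁` (K0a FILE 11a, p496273) and at the C¹-route witness θ₁₅ᶜᶜ¹ = `theta13OfThm1CC1 F N ε₀ e B₃ B₃' a₀ a₁` (K0a FILE 13a, p505383) -/

section RowsBelowWitnesses

variable (ε₀ B₃ B₃' a₀ a₁ : ℝ) (c₀ : B13.Consts) (M : ℕ) (α₂ B : ℝ)

variable {ε₀ B₃ a₀ a₁} in
/-- **The (D4) lane's β-side rows below a threshold AT θ₁₅ᶜ** (rows G, Z, N1 at the faithful letters, the seam `e·K_rem,L ≤ s`, `4e < ε₀`, for every member `0 < e ≤ ē`): §0 at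
`n := stage12NumericsOfThm1C F.L ε₀ B₃ a₀ a₁`, accepted as a TERM of the θ₁₅ᶜ-spelled statement (`theta13OfThm1C_eq` is `rfl`) — the rows-below twin of dag-n26-c's member lemma
`exists_eps29_rows_theta13OfThm1C` (p497784 §1c) and the check that §1 reads θ₁₅ᶜ (P3 EVIDENCE-58 §11 (v)) by one application.
[cite: Balaban1987RG1, (0.21) p.256, (1.2) p.260, (2.9) p.266 and (1.22) p.264; Balaban1988RG2Cluster, Lemma 3 (2.38) p.20 and p.21 (after (2.39), after (2.41)); Balaban1988Convergent, (2.4) p.255, (2.10) p.256; Balaban1985Variational, Thm 1 p.279] -/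
theorem exists_thr_rows_theta13OfThm1C (hε : 0 < ε₀) (hB : 0 ≤ B₃) (ha₀ : 0 < a₀) (ha₁ : 0 < a₁) {s : ℝ} (hs : 0 < s) :
    ∃ ē : ℝ, 0 < ē ∧ ∀ e : ℝ, 0 < e → e ≤ ē →
      4 * e < ε₀ ∧
      (theta13OfThm1C F N ε₀ e B₃ a₀ a₁).Admissible F N ∧ (theta13OfThm1C F N ε₀ e B₃ a₀ a₁).ZtUnity F N ∧
      CondsL 4 (c13OfRecord₁₂ F N (theta13OfThm1C F N ε₀ e B₃ a₀ a₁).toStage12Params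
          { c₀ with ε₁ := e, A₂ := Real.exp 1 * 9 * 64 * K₀ 64 8 ^ 2 })
        (((c13OfRecord₁₂ F N (theta13OfThm1C F N ε₀ e B₃ a₀ a₁).toStage12Params
          { c₀ with ε₁ := e, A₂ := Real.exp 1 * 9 * 64 * K₀ 64 8 ^ 2 }).L : ℝ) / 2) ∧
      e * remCoeffL 4 M (c13OfRecord₁₂ F N (theta13OfThm1C F N ε₀ e B₃ a₀ a₁).toStage12Params
          { c₀ with ε₁ := e, A₂ := Real.exp 1 * 9 * 64 * K₀ 64 8 ^ 2 }) α₂ B ≤ s :=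
  exists_thr_rows_theta13LiveOfNumerics F N c₀ M α₂ B (n := stage12NumericsOfThm1C F.L ε₀ B₃ a₀ a₁)
    (kappaThreshold_le_2e4.trans (kp_n10_theta13OfThm1C F N ε₀ 0 B₃ a₀ a₁)) (stage12NumericsOfThm1C_pos hε hB ha₀ ha₁) hs


variable {ε₀ B₃ B₃' a₀ a₁} in
/-- **The (D4) lane's β-side rows below a threshold AT THE C¹-ROUTE WITNESS θ₁₅ᶜᶜ¹** (ym-nodeO-ideate P3 EVIDENCE-59: «CondsL rows at θ₁₅ᶜᶜ¹ = the next typed input»; the threshold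
form its `…_below` knit consumes): §0 at `n := stage12NumericsOfThm1CC1 F.L ε₀ B₃ B₃' a₀ a₁`, accepted as a TERM of the θ₁₅ᶜᶜ¹-spelled statement (`theta13OfThm1CC1_eq` is `rfl`) — the
check that §1 reads θ₁₅ᶜᶜ¹ by one application.  The member-form faces at θ₁₅ᶜᶜ¹ (κ face, N1 iff, one member per slope, family road) are dag-n26-c's `…N26AtTheta13OfThm1CC1`, not restated.
[cite: Balaban1987RG1, (0.21) p.256, (1.2) p.260, (2.9) p.266 and (1.22) p.264; Balaban1988RG2Cluster, Lemma 3 (2.38) p.20 and p.21 (after (2.39), after (2.41)); Balaban1988Convergent, (2.4) p.255, (2.10) p.256; Balaban1985Variational, Thm 1 p.279] -/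
theorem exists_thr_rows_theta13OfThm1CC1 (hε : 0 < ε₀) (hB : 0 ≤ B₃) (hB' : 0 ≤ B₃') (ha₀ : 0 < a₀) (ha₁ : 0 < a₁) {s : ℝ} (hs : 0 < s) :
    ∃ ē : ℝ, 0 < ē ∧ ∀ e : ℝ, 0 < e → e ≤ ē →
      4 * e < ε₀ ∧
      (theta13OfThm1CC1 F N ε₀ e B₃ B₃' a₀ a₁).Admissible F N ∧ (theta13OfThm1CC1 F N ε₀ e B₃ B₃' a₀ a₁).ZtUnity F N ∧
      CondsL 4 (c13OfRecord₁₂ F N (theta13OfThm1CC1 F N ε₀ e B₃ B₃' a₀ a₁).toStage12Params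
          { c₀ with ε₁ := e, A₂ := Real.exp 1 * 9 * 64 * K₀ 64 8 ^ 2 })
        (((c13OfRecord₁₂ F N (theta13OfThm1CC1 F N ε₀ e B₃ B₃' a₀ a₁).toStage12Params
          { c₀ with ε₁ := e, A₂ := Real.exp 1 * 9 * 64 * K₀ 64 8 ^ 2 }).L : ℝ) / 2) ∧
      e * remCoeffL 4 M (c13OfRecord₁₂ F N (theta13OfThm1CC1 F N ε₀ e B₃ B₃' a₀ a₁).toStage12Params
          { c₀ with ε₁ := e, A₂ := Real.exp 1 * 9 * 64 * K₀ 64 8 ^ 2 }) α₂ B ≤ s :=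
  exists_thr_rows_theta13LiveOfNumerics F N c₀ M α₂ B (n := stage12NumericsOfThm1CC1 F.L ε₀ B₃ B₃' a₀ a₁)
    (kappaThreshold_le_2e4.trans (kp_n10_theta13OfThm1CC1 F N ε₀ 0 B₃ B₃' a₀ a₁)) (stage12NumericsOfThm1CC1_pos hε hB hB' ha₀ ha₁) hs

end RowsBelowWitnesses

end Summit.QuantumFields.YangMills.Theorems.BalabanUVNodesN26AtTheta13LiveStubD4BelowOfDriftTowerFlat

end
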